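import Summits.QuantumAdvantage.QuantumAdvantage.Theorems.CharDialBlockDialE
import HarnessLib

/-!
# The mask dial, part E: the VANDERMONDE presentation separates the mask dial from the null dial (decomp-qadv lens-6 g18 «NullDial» REV2, tree part 31G)

For a prime `p ≡ 1 (mod 3)` and `γ` of order `p − 1` (a primitive root), the junta-free presentation `vdmData p n γ` — every cut carries the
geometric coefficient vector `i ↦ γ^i` — has NO zero-sum window `[S, S+ℓ)` of any length `ℓ ≢ 0 (mod 3)` (`vdm_window_ne_zero`:
`γ^S · (γ^ℓ − 1)/(γ − 1) ≠ 0` since `(p−1) ∤ ℓ`), while the `p`-SETS `{k·p(p−1) + j(p−1) : j < p}` = the traces of the residue class `0 (mod p−1)`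
(`vdmMask`) on the separated spans `[k·p(p−1), k·p(p−1) + (p−1)²+1)` (`vdmS`) have size `p` (`vdm_zblk_card`) and ZERO SUM (`vdm_zblk_sum`:
`p·γ^{S k} = 0`).  ★ `vdm_separation`: for every prime `p ≥ 5`, `p ≡ 1 (mod 3)`, some `γ` and all large `n`, the presentation satisfies the
mask-dial hypothesis (tree part 31F `maskDial_hard`, inlined) and violates the null-dial hypothesis (tree part 31A `nullDial_hard`, inlined) — the
mask dial is STRICTLY larger at the level of presentations.  Independent of parts 31C–31F (masked blocks written as `(blk ℓ S k).filter (· ∈ Z)`,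
which is `MaskDial.zblk ℓ S Z k` by `rfl`).
Supports item stmt-QuantumAdvantage-32604 (`CharDial.WalkHardFJLinOdd`); source: pub annex g18/OrbitDial38.lean REV2 (sha256 7aeccba348e162ea…) §38i,
namespace `…Theses.OrbitDial` (`vdmData`, `vdm_not_nullHyp`, `vdm_maskHyp`, `maskHyp_not_nullHyp`), statements and proofs verbatim with the
dial hypotheses `NullHyp`/`MaskHyp` inlined (Prop-free).
-/

set_option autoImplicit false

namespace Summit.QuantumAdvantage.AdviceFreeQNC0.JLinPeel.MaskDial

open Finset
open Summit.QuantumAdvantage.AdviceFreeQNC0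
open Summit.QuantumAdvantage.AdviceFreeQNC0.JLinPeel.BlockDial

section VdmSeparation
variable {p n : ℕ}

/-- the VANDERMONDE presentation: no juntas, every cut carries the same geometric coefficient vector `i ↦ γ^i`, tables `[x = 0]`. -/
noncomputable def vdmData (p n : ℕ) (γ : ZMod p) : JLinPeel.JLinData p n where
  J := fun _ => ∅
  a := fun _ i => γ ^ i.val
  h := fun _ _ x => decide (x = 0)
  hJ := fun _ _ _ _ _ => rfl

/-- CharDialMaskDialE helper `vdmData_J` (decomp-qadv land package; see the module docstring). -/
theorem vdmData_J (γ : ZMod p) (g : Fin (n + 1)) : (vdmData p n γ).J g = ∅ := rfl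
/-- CharDialMaskDialE helper `vdmData_a` (decomp-qadv land package; see the module docstring). -/
theorem vdmData_a (γ : ZMod p) (g : Fin (n + 1)) (i : Fin n) : (vdmData p n γ).a g i = γ ^ i.val := rfl

/-- a window is the image of `Fin ℓ` under translation. -/
theorem vdm_blk_eq_image {M ℓ : ℕ} (S : Fin M → ℕ) (k : Fin M) (hfit : S k + ℓ ≤ n) :
    blk (n := n) ℓ S k = univ.image fun t : Fin ℓ => (⟨S k + t.val, by have := t.isLt; omega⟩ : Fin n) := by
  ext i
  rw [mem_blk, mem_image]
  constructor
  · rintro ⟨h1, h2⟩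
    refine ⟨⟨i.val - S k, by omega⟩, mem_univ _, Fin.ext ?_⟩
    show S k + (i.val - S k) = i.val
    omega
  · rintro ⟨t, -, rfl⟩
    have := t.isLt
    show S k ≤ S k + t.val ∧ S k + t.val < S k + ℓ
    omega

/-- the geometric window sum: `∑_{i ∈ [S k, S k+ℓ)} γ^i = γ^{S k} · ∑_{t<ℓ} γ^t`. -/
theorem vdm_window_sum {M ℓ : ℕ} (γ : ZMod p) (S : Fin M → ℕ) (k : Fin M) (hfit : S k + ℓ ≤ n) :
    ∑ i ∈ blk (n := n) ℓ S k, γ ^ i.val = γ ^ (S k) * ∑ t ∈ range ℓ, γ ^ t := by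
  rw [vdm_blk_eq_image S k hfit, Finset.sum_image, Finset.mul_sum, ← Fin.sum_univ_eq_sum_range]
  · refine Finset.sum_congr rfl fun t _ => ?_
    show γ ^ (S k + t.val) = γ ^ S k * γ ^ t.val
    rw [pow_add]
  · intro t _ t' _ h
    have := Fin.ext_iff.mp h
    exact Fin.ext (by simpa using this)

/-- **no zero-sum window of length `≢ 0 (mod 3)`** for the Vandermonde vector of an element of order `p − 1` when `p ≡ 1 (mod 3)` (`p` prime). -/
theorem vdm_window_ne_zero [Fact p.Prime] {M ℓ : ℕ} (hp1 : p % 3 = 1) {γ : ZMod p} (hγ0 : γ ≠ 0) (hord : orderOf γ = p - 1)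
    (hℓ3 : ℓ % 3 = 1 ∨ ℓ % 3 = 2) (S : Fin M → ℕ) (k : Fin M) (hfit : S k + ℓ ≤ n) :
    ∑ i ∈ blk (n := n) ℓ S k, γ ^ i.val ≠ 0 := by
  rw [vdm_window_sum γ S k hfit]
  intro h
  have hG : ∑ t ∈ range ℓ, γ ^ t = 0 := by
    rcases mul_eq_zero.mp h with h0 | h0
    · exact absurd h0 (pow_ne_zero _ hγ0)
    · exact h0
  have hgeom : (∑ t ∈ range ℓ, γ ^ t) * (γ - 1) = γ ^ ℓ - 1 := geom_sum_mul γ ℓ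
  rw [hG, zero_mul] at hgeom
  have hpow : γ ^ ℓ = 1 := by
    have := hgeom.symm
    rwa [sub_eq_zero] at this
  have hdvd : p - 1 ∣ ℓ := by
    rw [← hord]
    exact orderOf_dvd_iff_pow_eq_one.mpr hpow
  have h3 : 3 ∣ p - 1 := by omega
  have h3ℓ : 3 ∣ ℓ := h3.trans hdvd
  rcases hℓ3 with h | h <;> omega

/-- the mask `Z = {i : (p−1) ∣ i}`. -/
def vdmMask (p n : ℕ) : Finset (Fin n) := univ.filter fun i => p - 1 ∣ i.val

/-- the span starts `S k = k·(p·(p−1))`. -/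
def vdmS (p : ℕ) {M : ℕ} (k : Fin M) : ℕ := k.val * (p * (p - 1))

/-- the points of a masked block lie in the cube. -/
theorem vdm_bound {M : ℕ} (hp2 : 2 ≤ p) (k : Fin M) (hfit : vdmS p k + ((p - 1) * (p - 1) + 1) ≤ n) {j : ℕ} (hj : j < p) :
    vdmS p k + j * (p - 1) < n := by
  have h1 : j * (p - 1) ≤ (p - 1) * (p - 1) := Nat.mul_le_mul_right _ (by omega)
  omega

/-- the translation `j ↦ S k + j(p−1)` into the cube is injective. -/
theorem vdm_inj {M : ℕ} (hp2 : 2 ≤ p) (k : Fin M) (hfit : vdmS p k + ((p - 1) * (p - 1) + 1) ≤ n) :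
    Function.Injective (fun j : Fin p => (⟨vdmS p k + j.val * (p - 1), vdm_bound hp2 k hfit j.isLt⟩ : Fin n)) := by
  intro j j' h
  have e := Fin.ext_iff.mp h
  have e' : vdmS p k + j.val * (p - 1) = vdmS p k + j'.val * (p - 1) := e
  have e'' : j.val * (p - 1) = j'.val * (p - 1) := by omega
  exact Fin.ext (Nat.eq_of_mul_eq_mul_right (by omega) e'')

/-- the masked block `k` of the Vandermonde spans is `{S k + j(p−1) : j < p}`. -/
theorem vdm_zblk_eq {M : ℕ} (hp2 : 2 ≤ p) (k : Fin M) (hfit : vdmS p k + ((p - 1) * (p - 1) + 1) ≤ n) :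
    (blk ((p - 1) * (p - 1) + 1) (fun k : Fin M => vdmS p k) k).filter (fun i => i ∈ vdmMask p n)
      = univ.image fun j : Fin p => (⟨vdmS p k + j.val * (p - 1), vdm_bound hp2 k hfit j.isLt⟩ : Fin n) := by
  have hd : 1 ≤ p - 1 := by omega
  have hSk : p - 1 ∣ vdmS p k := ⟨k.val * p, by unfold vdmS; ring⟩
  have hpp : (p - 1) * p = (p - 1) * (p - 1) + (p - 1) := by
    rw [show (p - 1) * p = (p - 1) * ((p - 1) + 1) by congr 1; omega, Nat.mul_succ]
  ext i
  rw [mem_filter, mem_blk, mem_image, vdmMask, mem_filter]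
  constructor
  · rintro ⟨⟨h1, h2⟩, -, hdi⟩
    have hdt : p - 1 ∣ i.val - vdmS p k := Nat.dvd_sub hdi hSk
    obtain ⟨j, hj⟩ := hdt
    have hj' : i.val - vdmS p k = j * (p - 1) := by rw [hj, mul_comm]
    have hjp : j < p := by
      by_contra hlt
      have h3 : p * (p - 1) ≤ j * (p - 1) := Nat.mul_le_mul_right _ (by omega)
      have h4 : p * (p - 1) = (p - 1) * (p - 1) + (p - 1) := by rw [mul_comm]; exact hpp
      omega
    refine ⟨⟨j, hjp⟩, mem_univ _, Fin.ext ?_⟩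
    show vdmS p k + j * (p - 1) = i.val
    omega
  · rintro ⟨j, -, rfl⟩
    have hjle : j.val * (p - 1) ≤ (p - 1) * (p - 1) := Nat.mul_le_mul_right _ (by omega)
    refine ⟨⟨?_, ?_⟩, mem_univ _, ?_⟩
    · show vdmS p k ≤ vdmS p k + j.val * (p - 1)
      omega
    · show vdmS p k + j.val * (p - 1) < vdmS p k + ((p - 1) * (p - 1) + 1)
      omega
    · show p - 1 ∣ vdmS p k + j.val * (p - 1)
      exact Nat.dvd_add hSk (Dvd.intro_left j.val rfl)

/-- the masked blocks have size `p`. -/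
theorem vdm_zblk_card {M : ℕ} (hp2 : 2 ≤ p) (k : Fin M) (hfit : vdmS p k + ((p - 1) * (p - 1) + 1) ≤ n) :
    ((blk ((p - 1) * (p - 1) + 1) (fun k : Fin M => vdmS p k) k).filter (fun i => i ∈ vdmMask p n)).card = p := by
  rw [vdm_zblk_eq hp2 k hfit, Finset.card_image_of_injective _ (vdm_inj hp2 k hfit), card_univ, Fintype.card_fin]

/-- **the masked blocks are zero-sum** for the Vandermonde vector of any `γ` with `γ^{p−1} = 1`: `∑_{j<p} γ^{S k + j(p−1)} = p·γ^{S k} = 0`. -/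
theorem vdm_zblk_sum {M : ℕ} (hp2 : 2 ≤ p) {γ : ZMod p} (hγ : γ ^ (p - 1) = 1) (k : Fin M)
    (hfit : vdmS p k + ((p - 1) * (p - 1) + 1) ≤ n) :
    ∑ i ∈ (blk ((p - 1) * (p - 1) + 1) (fun k : Fin M => vdmS p k) k).filter (fun i => i ∈ vdmMask p n), γ ^ i.val = 0 := by
  rw [vdm_zblk_eq hp2 k hfit, Finset.sum_image fun j _ j' _ h => vdm_inj hp2 k hfit h]
  have e : ∀ j : Fin p, γ ^ ((⟨vdmS p k + j.val * (p - 1), vdm_bound hp2 k hfit j.isLt⟩ : Fin n)).val = γ ^ (vdmS p k) := by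
    intro j
    show γ ^ (vdmS p k + j.val * (p - 1)) = γ ^ (vdmS p k)
    rw [pow_add, pow_mul', hγ, one_pow, mul_one]
  rw [Finset.sum_congr rfl fun j _ => e j, Finset.sum_const, card_univ, Fintype.card_fin, nsmul_eq_mul, ZMod.natCast_self, zero_mul]

/-- an element of order `p − 1` in `ℤ/p` (a primitive root), `p` prime. -/
theorem vdm_exists_orderOf_eq (p : ℕ) [Fact p.Prime] : ∃ γ : ZMod p, γ ≠ 0 ∧ orderOf γ = p - 1 := by
  obtain ⟨g, hg⟩ := IsCyclic.exists_ofOrder_eq_natCard (α := (ZMod p)ˣ)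
  refine ⟨(g : ZMod p), g.ne_zero, ?_⟩
  rw [orderOf_units, hg, Nat.card_eq_fintype_card, ZMod.card_units p]

/-- **the Vandermonde presentation escapes the NULL dial** (inlined `NullHyp`; `p ≡ 1 (mod 3)` prime, `γ` of order `p − 1`, every `n`). -/
theorem vdm_not_nullHyp [Fact p.Prime] (hp1 : p % 3 = 1) {γ : ZMod p} (hγ0 : γ ≠ 0) (hord : orderOf γ = p - 1) (n : ℕ) :
    ¬ (∃ (ℓ M : ℕ) (S : Fin M → ℕ), (ℓ % 3 = 1 ∨ ℓ % 3 = 2) ∧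
        ((∀ k k' : Fin M, k < k' → S k + ℓ ≤ S k') ∧ (∀ k : Fin M, S k + ℓ ≤ n)) ∧
        2 ^ ℓ * ((Nat.log 2 n + 1) * (Nat.log 2 n + 1) + 1) ≤ M ∧
          ∀ g (k : Fin M), ∑ i ∈ blk ℓ S k, (vdmData p n γ).a g i = 0) := by
  rintro ⟨ℓ, M, S, hℓ3, hS, hM, hnull⟩
  have h2 : 1 ≤ 2 ^ ℓ := Nat.one_le_two_pow
  have hM1 : 1 ≤ M := by nlinarith [hM, h2]
  exact vdm_window_ne_zero hp1 hγ0 hord hℓ3 S ⟨0, hM1⟩ (hS.2 _) (hnull 0 ⟨0, hM1⟩)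

/-- **the Vandermonde presentation meets the MASK dial** (inlined `MaskHyp`; all large `n`; `p ≥ 2`, `p ≡ 1 (mod 3)`, `γ^{p−1} = 1`): span length
`(p−1)²+1`, spans at `k·p(p−1)`, mask `{i : (p−1) ∣ i}`, masked blocks of size `m = p`. -/
theorem vdm_maskHyp (hp2 : 2 ≤ p) (hp1 : p % 3 = 1) {γ : ZMod p} (hγ : γ ^ (p - 1) = 1) :
    ∃ n₁ : ℕ, ∀ n ≥ n₁, ∃ (ℓ m M : ℕ) (S : Fin M → ℕ) (Z : Finset (Fin n)), (m % 3 = 1 ∨ m % 3 = 2) ∧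
      ((∀ k k' : Fin M, k < k' → S k + ℓ ≤ S k') ∧ (∀ k : Fin M, S k + ℓ ≤ n)) ∧
      (∀ k : Fin M, ((blk ℓ S k).filter (fun i => i ∈ Z)).card = m) ∧
      2 ^ m * ((Nat.log 2 n + 1) * (Nat.log 2 n + 1) + 1) ≤ M ∧
        ∀ g (k : Fin M), ∑ i ∈ (blk ℓ S k).filter (fun i => i ∈ Z), (vdmData p n γ).a g i = 0 := by
  obtain ⟨m₀, hm₀⟩ := DWalk.const_mul_logPow_le' (5 * 2 ^ p * (p * (p - 1))) 2
  refine ⟨max m₀ 4, fun n hn => ?_⟩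
  have hn₀ : m₀ ≤ n := le_trans (le_max_left _ _) hn
  have hn4 : 4 ≤ n := le_trans (le_max_right _ _) hn
  have hlog := hm₀ n hn₀
  have hL1 : 1 ≤ Nat.log 2 n := Nat.log_pos (by norm_num) (by omega)
  set L : ℕ := Nat.log 2 n with hL
  set M : ℕ := 2 ^ p * ((L + 1) * (L + 1) + 1) with hM
  have hpp : p * (p - 1) = (p - 1) * (p - 1) + (p - 1) := by
    rw [mul_comm, show (p - 1) * p = (p - 1) * ((p - 1) + 1) by congr 1; omega, Nat.mul_succ]
  have hbudget : M * (p * (p - 1)) ≤ n := by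
    have h5 : (L + 1) * (L + 1) + 1 ≤ 5 * L ^ 2 := by nlinarith [hL1]
    have hM5 : M ≤ 2 ^ p * (5 * L ^ 2) := Nat.mul_le_mul_left _ h5
    have h6 : M * (p * (p - 1)) ≤ 2 ^ p * (5 * L ^ 2) * (p * (p - 1)) := Nat.mul_le_mul_right _ hM5
    have e : 2 ^ p * (5 * L ^ 2) * (p * (p - 1)) = 5 * 2 ^ p * (p * (p - 1)) * L ^ 2 := by ring
    rw [e] at h6
    exact le_trans h6 hlog
  have hfit : ∀ k : Fin M, vdmS p k + ((p - 1) * (p - 1) + 1) ≤ n := by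
    intro k
    have h1 : (k.val + 1) * (p * (p - 1)) ≤ M * (p * (p - 1)) := Nat.mul_le_mul_right (p * (p - 1)) k.isLt
    rw [Nat.add_mul, one_mul] at h1
    unfold vdmS
    omega
  have hsep : ∀ k k' : Fin M, k < k' → vdmS p k + ((p - 1) * (p - 1) + 1) ≤ vdmS p k' := by
    intro k k' hkk
    have hkk' : k.val + 1 ≤ k'.val := hkk
    have h1 : (k.val + 1) * (p * (p - 1)) ≤ k'.val * (p * (p - 1)) := Nat.mul_le_mul_right (p * (p - 1)) hkk'
    rw [Nat.add_mul, one_mul] at h1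
    unfold vdmS
    omega
  exact ⟨(p - 1) * (p - 1) + 1, p, M, fun k => vdmS p k, vdmMask p n, Or.inl hp1, ⟨hsep, hfit⟩,
    fun k => vdm_zblk_card hp2 k (hfit k), le_rfl, fun g k => vdm_zblk_sum hp2 hγ k (hfit k)⟩

/-- ★ **THE MASK DIAL IS STRICTLY LARGER THAN THE NULL DIAL (presentation level).**  For every prime `p ≥ 5` with `p ≡ 1 (mod 3)` there are `γ` (a
primitive root) and `n₁` such that for all `n ≥ n₁` the junta-free Vandermonde presentation `vdmData p n γ` satisfies the (inlined) mask-dial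
hypothesis and violates the (inlined) null-dial hypothesis. -/
theorem vdm_separation (p : ℕ) [hp : Fact p.Prime] (hp5 : 5 ≤ p) (hp1 : p % 3 = 1) :
    ∃ γ : ZMod p, ∃ n₁ : ℕ, ∀ n ≥ n₁,
      (∀ g, ((vdmData p n γ).J g).card ≤ Nat.log 2 n) ∧
      (∃ (ℓ m M : ℕ) (S : Fin M → ℕ) (Z : Finset (Fin n)), (m % 3 = 1 ∨ m % 3 = 2) ∧
        ((∀ k k' : Fin M, k < k' → S k + ℓ ≤ S k') ∧ (∀ k : Fin M, S k + ℓ ≤ n)) ∧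
        (∀ k : Fin M, ((blk ℓ S k).filter (fun i => i ∈ Z)).card = m) ∧
        2 ^ m * ((Nat.log 2 n + 1) * (Nat.log 2 n + 1) + 1) ≤ M ∧
          ∀ g (k : Fin M), ∑ i ∈ (blk ℓ S k).filter (fun i => i ∈ Z), (vdmData p n γ).a g i = 0) ∧
      ¬ (∃ (ℓ M : ℕ) (S : Fin M → ℕ), (ℓ % 3 = 1 ∨ ℓ % 3 = 2) ∧
        ((∀ k k' : Fin M, k < k' → S k + ℓ ≤ S k') ∧ (∀ k : Fin M, S k + ℓ ≤ n)) ∧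
        2 ^ ℓ * ((Nat.log 2 n + 1) * (Nat.log 2 n + 1) + 1) ≤ M ∧
          ∀ g (k : Fin M), ∑ i ∈ blk ℓ S k, (vdmData p n γ).a g i = 0) := by
  obtain ⟨γ, hγ0, hord⟩ := vdm_exists_orderOf_eq p
  have hγ : γ ^ (p - 1) = 1 := by rw [← hord]; exact pow_orderOf_eq_one γ
  obtain ⟨n₁, hn₁⟩ := vdm_maskHyp (by omega) hp1 hγ
  exact ⟨γ, n₁, fun n hn => ⟨fun g => by rw [vdmData_J]; simp, hn₁ n hn, vdm_not_nullHyp hp1 hγ0 hord n⟩⟩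

end VdmSeparation

end Summit.QuantumAdvantage.AdviceFreeQNC0.JLinPeel.MaskDial
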